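import Summits.QuantumFields.YangMills.Theorems.BalabanUVNodesN15KingModelTwoPointCommutingSquare
import Summits.QuantumFields.YangMills.Theorems.BalabanUVNodesN15KingModelTwoPointInfiniteVolumeSymmetry

/-!
# BalabanUVNodes ∕ N15 — THE KING-MODEL RUNG (PART Ϝ-p): THE FINITE-`K` INFINITE-VOLUME KERNEL `V_{L^K}` — EXPONENTIAL DECAY, SUSCEPTIBILITY `m⁻²`, POSITIVITY
# (Track A, DAG node N15 = NE2; FAN-OUT v1.1 §N15 s3 «KING-MODEL RUNG … NE2's analogue DECIDED in the model»)

HONEST FRAMING.  Count-neutral (cell `pub-ymgap`, seat `pub-ymgap-dag-n15-e` g33; `--supports stmt-QuantumFields-27366 --as helper` = K3⁸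
`SpineGivenEndpointR13SepCoPHV`).  TEMPLATE LITERATURE: C. King, *The U(1) Higgs model. I. The continuum limit*, Commun. Math. Phys. **102** (1986) 649–677
[King1986] — KING's OWN `A = 0`, `g = 0` MODEL at FIXED fine spacing `η = L^{−K}`, infinite volume (part Ϝ-n's `kingS2InfK`).  The finite-`K` column of the square of
part Ϝ-o receives the same three structural facts as the `K = ∞` column (parts Ϝ-k∕Ϝ-m): exponential clustering at the Combes–Thomas rate `κ_M∕2`, the exact
susceptibility `m⁻²`, positive-definiteness.  NOT the interacting model; NOT Bałaban's objects; NOT a node discharge (N15 is booked through n15-a's knit, untouched here);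
nothing continuum-Yang–Mills ∕ ℝ⁴ ∕ OS ∕ mass-gap ∕ Clay.  0 `sorry`; standard axioms; ONE plumbing def (`repKernelK`).

THE MATHEMATICS.  On every unit torus, `|S₂^{(K)}_Ω(0,b)| ≤ |S₂^{(K)} − S₂^{(∞)}| + |S₂^{(∞)}| ≤ (2C_diff + a_∞⁻¹ + 2∕γ_m)·e^{−(κ_M∕2)d_T(0,b)}` for `b ≠ 0` (parts Ϝ-d, Ϡ-j; `L^{−K} ≤ 1`,
`e^{−κd} ≤ e^{−κd∕2}`), `|S₂^{(K)}_Ω(0,0)| ≤ m⁻²`, and `Σ_b S₂^{(K)}_Ω(0,b) = m⁻²` EXACTLY (part Ϝ-h).  Exactly as in part Ϝ-k (centred representatives, the uniform majorant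
`(m⁻² + C′)Π_ν e^{−(κ_M∕(2(d+1)))|z_ν|}`, Tannery) these pass through part Ϝ-n's thermodynamic limit: `|V_{L^K}(z)| ≤ C′e^{−(κ_M∕2)|z_ν|}` (`z ≠ 0`, every `ν`), `V_{L^K}` summable,
`Σ_{z∈ℤ^{d+1}} V_{L^K}(z) = m⁻²`; and part Ϝ-d's torus positivity pushed forward (part Ϝ-m's letter) gives positive-definiteness of `V_{L^K}` on `ℤ^{d+1}`.

WHAT THIS FILE PROVES (kernel).  §1 ★ `abs_kingS2_le_decay` (uniform torus decay at finite `K`).  §2 ★★ **`abs_kingS2InfK_le_decay`**.  §3 `repKernelK`, `repKernelK_torRep`, `tsum_repKernelK_eq`,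
`abs_repKernelK_le`, `tendsto_repKernelK`, ★ `summable_kingS2InfK`, ★★★ **`tsum_kingS2InfK_eq_inv_mass`** (`Σ_z V_{L^K}(z) = m⁻²`).  §4 `kingS2_transl`, ★★ **`kingS2InfK_posSemidef`**.

HONEST SCOPE.  Free field; unit-block smearing; `m² > 0`; `N = L^K`, `K ≥ 1`, odd `L ≥ 3` de facto; auxiliary `a > 0` in the constants only.  N15 untouched; counts unmoved.
Locators: [King1986] Thm 2.1 (2.22)–(2.23) p.654, Thm 3.3 (3.6) p.655, Lemma 4.5 (4.38) p.674, (4.5) p.670.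
-/

noncomputable section

open scoped BigOperators
open Finset Filter Topology

namespace Summit.QuantumFields.YangMills.BalabanUVNodes.N15KingModelRung

open Literature.MathematicalPhysics.QuantumFieldTheory.Balaban1983to89.B5Prop11Plancherel (Tor fine chi sOf)
open Literature.MathematicalPhysics.QuantumFieldTheory.King1986 (aK)
open Literature.MathematicalPhysics.QuantumFieldTheory.King1986.Torus

variable {d : ℕ}

/-! ## §1 Uniform exponential decay of the finite-`K` torus kernel -/

/-- ★ **UNIFORM DECAY AT FINITE `K`**: for odd `L ≥ 2`, `a, m² > 0`, `K ≥ 1`, every unit torus and `b ≠ b′`: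
`|S₂^{(K)}_Ω(b,b′)| ≤ (2C_diff + a_∞⁻¹ + 2∕γ_m)·e^{−(κ_M∕2)d_T(b,b′)}`. [cite: King1986, Thm 3.3 (3.6) p.655, Lemma 4.5 (4.38) p.674] -/
theorem abs_kingS2_le_decay (L : ℕ) (M : Fin (d + 1) → ℕ) [∀ ν, NeZero (M ν)] (hLodd : Odd L) (hL : 2 ≤ L) {a m2 : ℝ} (ha : 0 < a) (hm : 0 < m2) {K : ℕ} (hK : 1 ≤ K)
    {b b' : Tor M} (hbb : b ≠ b') :
    haveI : NeZero L := ⟨by omega⟩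
    |kingS2 (L ^ K) M m2 b b'| ≤ (2 * CdiffM (d + 1) a m2 L + (aInf a L)⁻¹ + 2 / gamM a m2 L) * Real.exp (-(kapM (d + 1) a m2 L / 2 * tdistT M b b')) := by
  haveI : NeZero L := ⟨by omega⟩
  have hL1 : (1 : ℝ) < L := by exact_mod_cast (show 1 < L by omega)
  have hκ : 0 < kapM (d + 1) a m2 L := (kapM_pos_le (d := d + 1) ha hm hL).1
  have hγ : 0 < gamM a m2 L := gamM_pos ha hm hL
  have hC : 0 ≤ 2 * CdiffM (d + 1) a m2 L + (aInf a L)⁻¹ := by have := CdiffM_nonneg (d := d + 1) ha hm hL; have := aInf_pos ha hL1; positivity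
  have hd := tdistT_nonneg M b b'
  have h1 := abs_kingS2_sub_lim_le L M hLodd hL ha hm hK b b'
  have h2 := abs_kingS2Lim_le_decay L M hLodd hL ha hm hbb
  have hLK : ((L : ℝ) ^ K)⁻¹ ≤ 1 := inv_le_one_of_one_le₀ (one_le_pow₀ hL1.le)
  have hexp : Real.exp (-(kapM (d + 1) a m2 L * tdistT M b b')) ≤ Real.exp (-(kapM (d + 1) a m2 L / 2 * tdistT M b b')) :=
    Real.exp_le_exp.mpr (by nlinarith)
  have hE := Real.exp_pos (-(kapM (d + 1) a m2 L / 2 * tdistT M b b'))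
  calc |kingS2 (L ^ K) M m2 b b'| ≤ |kingS2 (L ^ K) M m2 b b' - kingS2Lim M m2 b b'| + |kingS2Lim M m2 b b'| := by
        have := abs_add_le (kingS2 (L ^ K) M m2 b b' - kingS2Lim M m2 b b') (kingS2Lim M m2 b b'); rwa [sub_add_cancel] at this
    _ ≤ (2 * CdiffM (d + 1) a m2 L + (aInf a L)⁻¹) * Real.exp (-(kapM (d + 1) a m2 L / 2 * tdistT M b b')) * ((L : ℝ) ^ K)⁻¹
        + 2 / gamM a m2 L * Real.exp (-(kapM (d + 1) a m2 L * tdistT M b b')) := add_le_add h1 h2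
    _ ≤ (2 * CdiffM (d + 1) a m2 L + (aInf a L)⁻¹) * Real.exp (-(kapM (d + 1) a m2 L / 2 * tdistT M b b')) * 1
        + 2 / gamM a m2 L * Real.exp (-(kapM (d + 1) a m2 L / 2 * tdistT M b b')) := by gcongr
    _ = (2 * CdiffM (d + 1) a m2 L + (aInf a L)⁻¹ + 2 / gamM a m2 L) * Real.exp (-(kapM (d + 1) a m2 L / 2 * tdistT M b b')) := by ring

/-! ## §2 Exponential decay of `V_{L^K}` -/

/-- ★★ **EXPONENTIAL DECAY OF THE FINITE-`K` INFINITE-VOLUME KERNEL**: `|V_{L^K}(z)| ≤ (2C_diff + a_∞⁻¹ + 2∕γ_m)·e^{−(κ_M∕2)|z_ν|}` for `z ≠ 0` and EVERY coordinate `ν`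
(`K ≥ 1`). [cite: King1986, Thm 3.3 (3.6) p.655, Thm 2.1 (2.22) p.654] -/
theorem abs_kingS2InfK_le_decay (L : ℕ) (hLodd : Odd L) (hL : 2 ≤ L) {a m2 : ℝ} (ha : 0 < a) (hm : 0 < m2) {K : ℕ} (hK : 1 ≤ K) {z : Fin (d + 1) → ℤ}
    (hz : z ≠ 0) (ν : Fin (d + 1)) :
    |kingS2InfK (L ^ K) m2 z| ≤ (2 * CdiffM (d + 1) a m2 L + (aInf a L)⁻¹ + 2 / gamM a m2 L) * Real.exp (-(kapM (d + 1) a m2 L / 2 * |(z ν : ℝ)|)) := by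
  haveI : NeZero L := ⟨by omega⟩
  have hLK : 1 ≤ L ^ K := Nat.one_le_pow K L (by omega)
  set Mseq : ℕ → Fin (d + 1) → ℕ := fun k _ => k + 1 with hMseq
  have hpos : ∀ k ν, 0 < Mseq k ν := fun k _ => Nat.succ_pos k
  have hlimM : ∀ ν, Tendsto (fun k => (Mseq k ν : ℝ)) atTop atTop := fun ν => by
    have : Tendsto (fun k : ℕ => ((k : ℝ) + 1)) atTop atTop := tendsto_atTop_add_const_right _ 1 tendsto_natCast_atTop_atTop
    exact this.congr fun k => by simp [hMseq]
  have hlim := tendsto_kingS2_volume (N := L ^ K) hLK hm Mseq hpos hlimM z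
  have hκ : 0 < kapM (d + 1) a m2 L := (kapM_pos_le (d := d + 1) ha hm hL).1
  refine le_of_tendsto ((continuous_abs.tendsto _).comp hlim) ?_
  have hev : ∀ μ, ∀ᶠ k in atTop, (2 * |z μ| : ℝ) < Mseq k μ := fun μ => (hlimM μ).eventually_gt_atTop _
  filter_upwards [Filter.eventually_all.mpr hev] with k hk
  haveI : ∀ μ, NeZero (Mseq k μ) := fun μ => ⟨(hpos k μ).ne'⟩
  set b : Tor (Mseq k) := fun μ => ((z μ : ℤ) : ZMod (Mseq k μ)) with hb
  have hrep : torRep (Mseq k) b = z := torRep_intCast_of_two_abs_lt (Mseq k) (fun μ => by exact_mod_cast hk μ)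
  have hb0 : (0 : Tor (Mseq k)) ≠ b := by
    intro h0; apply hz; rw [← hrep, ← h0]; funext μ; simp [torRep]
  have hdec := abs_kingS2_le_decay L (Mseq k) hLodd hL ha hm hK hb0
  have hdist : (|z ν| : ℝ) ≤ tdistT (Mseq k) 0 b := by
    have := abs_torRep_le_tdistT (Mseq k) b ν; rwa [hrep] at this
  simp only [Function.comp_apply]
  refine hdec.trans (mul_le_mul_of_nonneg_left (Real.exp_le_exp.mpr ?_) ?_)
  · have := mul_le_mul_of_nonneg_left hdist (half_pos hκ).le; linarith
  · have := CdiffM_nonneg (d := d + 1) ha hm hL; have := gamM_pos ha hm hL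
    have hL1 : (1 : ℝ) < L := by exact_mod_cast (show 1 < L by omega)
    have := aInf_pos ha hL1; positivity

/-! ## §3 The susceptibility sum rule for `V_{L^K}` -/

/-- The finite-`K` torus kernel transported to centred representatives. [folklore] -/
def repKernelK (N : ℕ) [NeZero N] (M : Fin (d + 1) → ℕ) [∀ ν, NeZero (M ν)] (m2 : ℝ) (z : Fin (d + 1) → ℤ) : ℝ :=
  if torRep M (fun ν => ((z ν : ℤ) : ZMod (M ν))) = z then kingS2 N M m2 0 (fun ν => ((z ν : ℤ) : ZMod (M ν))) else 0

/-- On representatives the transported kernel is the torus kernel. [folklore] -/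
theorem repKernelK_torRep (N : ℕ) [NeZero N] (M : Fin (d + 1) → ℕ) [∀ ν, NeZero (M ν)] (m2 : ℝ) (b : Tor M) :
    repKernelK N M m2 (torRep M b) = kingS2 N M m2 0 b := by
  have h := intCast_torRep M b
  unfold repKernelK
  rw [h, if_pos rfl]

/-- `Σ_{z∈ℤ^{d+1}} repKernelK_Ω(z) = m⁻²` (part Ϝ-h's finite-`K` sum rule, `N ≥ 1`). [cite: King1986, (4.5) p.670, (2.14) p.653] -/
theorem tsum_repKernelK_eq (N : ℕ) [NeZero N] (hN1 : 1 ≤ N) (M : Fin (d + 1) → ℕ) [∀ ν, NeZero (M ν)] {m2 : ℝ} (hm : 0 < m2) :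
    ∑' z : Fin (d + 1) → ℤ, repKernelK N M m2 z = m2⁻¹ := by
  have hsupp : Function.support (repKernelK N M m2) ⊆ Set.range (torRep M) := by
    intro z hz
    rw [Function.mem_support] at hz
    unfold repKernelK at hz
    by_cases h : torRep M (fun ν => ((z ν : ℤ) : ZMod (M ν))) = z
    · exact ⟨_, h⟩
    · rw [if_neg h] at hz; exact absurd rfl hz
  rw [← (torRep_injective M).tsum_eq hsupp, tsum_fintype]
  simp_rw [repKernelK_torRep]
  exact sum_kingS2_eq N M hN1 hm 0

/-- The uniform majorant: `|repKernelK_Ω(z)| ≤ (m⁻² + C′)·Π_ν e^{−(κ_M∕(2(d+1)))|z_ν|}` for EVERY unit torus (`K ≥ 1`). [cite: King1986, Thm 3.3 (3.6) p.655] -/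
theorem abs_repKernelK_le (L : ℕ) (hLodd : Odd L) (hL : 2 ≤ L) {a m2 : ℝ} (ha : 0 < a) (hm : 0 < m2) {K : ℕ} (hK : 1 ≤ K) (M : Fin (d + 1) → ℕ) [∀ ν, NeZero (M ν)]
    (z : Fin (d + 1) → ℤ) :
    haveI : NeZero L := ⟨by omega⟩
    |repKernelK (L ^ K) M m2 z| ≤ (m2⁻¹ + (2 * CdiffM (d + 1) a m2 L + (aInf a L)⁻¹ + 2 / gamM a m2 L))
      * ∏ ν, Real.exp (-(kapM (d + 1) a m2 L / 2 / (d + 1 : ℕ) * |(z ν : ℝ)|)) := by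
  haveI : NeZero L := ⟨by omega⟩
  have hL1 : (1 : ℝ) < L := by exact_mod_cast (show 1 < L by omega)
  have hκ : 0 < kapM (d + 1) a m2 L := (kapM_pos_le (d := d + 1) ha hm hL).1
  have hγ : 0 < gamM a m2 L := gamM_pos ha hm hL
  have hC : 0 ≤ 2 * CdiffM (d + 1) a m2 L + (aInf a L)⁻¹ + 2 / gamM a m2 L := by
    have := CdiffM_nonneg (d := d + 1) ha hm hL; have := aInf_pos ha hL1; positivity
  have hP0 : 0 < ∏ ν, Real.exp (-(kapM (d + 1) a m2 L / 2 / (d + 1 : ℕ) * |(z ν : ℝ)|)) := Finset.prod_pos fun ν _ => Real.exp_pos _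
  unfold repKernelK
  split_ifs with h
  · set b : Tor M := fun ν => ((z ν : ℤ) : ZMod (M ν)) with hb
    have hdist : ∀ ν, (|z ν| : ℝ) ≤ tdistT M 0 b := fun ν => by
      have := abs_torRep_le_tdistT M b ν; rwa [h] at this
    by_cases hb0 : (0 : Tor M) = b
    · have h1 := abs_kingS2_le (L ^ K) M hm 0 b
      have hP1 : ∏ ν, Real.exp (-(kapM (d + 1) a m2 L / 2 / (d + 1 : ℕ) * |(z ν : ℝ)|)) = 1 := by
        have hz0 : z = 0 := by rw [← h, ← hb0]; funext ν; simp [torRep]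
        simp [hz0]
      rw [hP1, mul_one]
      linarith
    · have h1 := abs_kingS2_le_decay L M hLodd hL ha hm hK hb0
      have h2 := exp_neg_le_prod_of_forall_le (d := d) (half_pos hκ).le hdist
      calc |kingS2 (L ^ K) M m2 0 b| ≤ (2 * CdiffM (d + 1) a m2 L + (aInf a L)⁻¹ + 2 / gamM a m2 L) * Real.exp (-(kapM (d + 1) a m2 L / 2 * tdistT M 0 b)) := h1
        _ ≤ (2 * CdiffM (d + 1) a m2 L + (aInf a L)⁻¹ + 2 / gamM a m2 L) * ∏ ν, Real.exp (-(kapM (d + 1) a m2 L / 2 / (d + 1 : ℕ) * |(z ν : ℝ)|)) :=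
            mul_le_mul_of_nonneg_left h2 hC
        _ ≤ _ := mul_le_mul_of_nonneg_right (by linarith [inv_pos.mpr hm]) hP0.le
  · rw [abs_zero]; positivity

/-- Termwise convergence: `repKernelK_{Ω_k}(z) → V_N(z)` along tori with all periods `→ ∞` (`N ≥ 1`). [cite: King1986, Thm 2.1 (2.22) p.654] -/
theorem tendsto_repKernelK {N : ℕ} [NeZero N] (hN1 : 1 ≤ N) {m2 : ℝ} (hm : 0 < m2) (Mseq : ℕ → Fin (d + 1) → ℕ) (hpos : ∀ k ν, 0 < Mseq k ν)
    (hlim : ∀ ν, Tendsto (fun k => (Mseq k ν : ℝ)) atTop atTop) (z : Fin (d + 1) → ℤ) :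
    Tendsto (fun k => haveI : ∀ ν, NeZero (Mseq k ν) := fun ν => ⟨(hpos k ν).ne'⟩
      repKernelK N (Mseq k) m2 z) atTop (𝓝 (kingS2InfK N m2 z)) := by
  have h1 := tendsto_kingS2_volume (N := N) hN1 hm Mseq hpos hlim z
  refine h1.congr' ?_
  have hev : ∀ μ, ∀ᶠ k in atTop, (2 * |z μ| : ℝ) < Mseq k μ := fun μ => (hlim μ).eventually_gt_atTop _
  filter_upwards [Filter.eventually_all.mpr hev] with k hk
  haveI : ∀ μ, NeZero (Mseq k μ) := fun μ => ⟨(hpos k μ).ne'⟩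
  have hrep := torRep_intCast_of_two_abs_lt (Mseq k) (fun μ => by exact_mod_cast hk μ)
  unfold repKernelK
  rw [if_pos hrep]

/-- ★ `V_{L^K}` is absolutely summable on `ℤ^{d+1}` (`K ≥ 1`). [cite: King1986, Thm 3.3 (3.6) p.655] -/
theorem summable_kingS2InfK (L : ℕ) (hLodd : Odd L) (hL : 2 ≤ L) {m2 : ℝ} (hm : 0 < m2) {K : ℕ} (hK : 1 ≤ K) :
    Summable fun z : Fin (d + 1) → ℤ => kingS2InfK (L ^ K) m2 z := by
  haveI : NeZero L := ⟨by omega⟩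
  have hLK : 1 ≤ L ^ K := Nat.one_le_pow K L (by omega)
  have hκ : 0 < kapM (d + 1) 1 m2 L := (kapM_pos_le (d := d + 1) one_pos hm hL).1
  have hκ' : 0 < kapM (d + 1) 1 m2 L / 2 / (d + 1 : ℕ) := by positivity
  refine Summable.of_norm_bounded ((summable_prod_exp_neg_abs hκ').mul_left (m2⁻¹ + (2 * CdiffM (d + 1) 1 m2 L + (aInf 1 L)⁻¹ + 2 / gamM 1 m2 L))) fun z => ?_
  rw [Real.norm_eq_abs]
  have hlim := tendsto_repKernelK (N := L ^ K) hLK hm (fun k _ => k + 1) (fun k _ => Nat.succ_pos k)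
    (fun ν => by
      have : Tendsto (fun k : ℕ => ((k : ℝ) + 1)) atTop atTop := tendsto_atTop_add_const_right _ 1 tendsto_natCast_atTop_atTop
      exact this.congr fun k => by push_cast; ring) z
  refine le_of_tendsto ((continuous_abs.tendsto _).comp hlim) (Filter.Eventually.of_forall fun k => ?_)
  haveI : ∀ ν : Fin (d + 1), NeZero ((fun (k : ℕ) (_ : Fin (d + 1)) => k + 1) k ν) := fun ν => ⟨Nat.succ_ne_zero k⟩
  exact abs_repKernelK_le L hLodd hL one_pos hm hK _ z

/-- ★★★ **THE SUSCEPTIBILITY SUM RULE FOR `V_{L^K}`**: `Σ_{z∈ℤ^{d+1}} V_{L^K}(z) = m⁻²` (`m² > 0`, `K ≥ 1`) — the static susceptibility is `m⁻²` at every finite `K` in infinite volume too.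
[cite: King1986, (4.5) p.670, Thm 2.1 (2.22)–(2.23) p.654] -/
theorem tsum_kingS2InfK_eq_inv_mass (L : ℕ) (hLodd : Odd L) (hL : 2 ≤ L) {m2 : ℝ} (hm : 0 < m2) {K : ℕ} (hK : 1 ≤ K) :
    ∑' z : Fin (d + 1) → ℤ, kingS2InfK (L ^ K) m2 z = m2⁻¹ := by
  haveI : NeZero L := ⟨by omega⟩
  have hLK : 1 ≤ L ^ K := Nat.one_le_pow K L (by omega)
  have hκ : 0 < kapM (d + 1) 1 m2 L := (kapM_pos_le (d := d + 1) one_pos hm hL).1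
  have hκ' : 0 < kapM (d + 1) 1 m2 L / 2 / (d + 1 : ℕ) := by positivity
  set Mseq : ℕ → Fin (d + 1) → ℕ := fun k _ => k + 1 with hMseq
  have hpos : ∀ k ν, 0 < Mseq k ν := fun k _ => Nat.succ_pos k
  have hlimM : ∀ ν, Tendsto (fun k => (Mseq k ν : ℝ)) atTop atTop := fun ν => by
    have : Tendsto (fun k : ℕ => ((k : ℝ) + 1)) atTop atTop := tendsto_atTop_add_const_right _ 1 tendsto_natCast_atTop_atTop
    exact this.congr fun k => by simp [hMseq]
  have htann := tendsto_tsum_of_dominated_convergence (𝓕 := atTop)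
    (f := fun k z => haveI : ∀ ν, NeZero (Mseq k ν) := fun ν => ⟨(hpos k ν).ne'⟩; repKernelK (L ^ K) (Mseq k) m2 z)
    (g := fun z => kingS2InfK (L ^ K) m2 z) ((summable_prod_exp_neg_abs hκ').mul_left (m2⁻¹ + (2 * CdiffM (d + 1) 1 m2 L + (aInf 1 L)⁻¹ + 2 / gamM 1 m2 L)))
    (fun z => tendsto_repKernelK (N := L ^ K) hLK hm Mseq hpos hlimM z)
    (Filter.Eventually.of_forall fun k z => by
      haveI : ∀ ν, NeZero (Mseq k ν) := fun ν => ⟨(hpos k ν).ne'⟩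
      rw [Real.norm_eq_abs]
      exact abs_repKernelK_le L hLodd hL one_pos hm hK (Mseq k) z)
  have hconst : (fun k => ∑' z : Fin (d + 1) → ℤ, haveI : ∀ ν, NeZero (Mseq k ν) := fun ν => ⟨(hpos k ν).ne'⟩; repKernelK (L ^ K) (Mseq k) m2 z)
      = fun _ => m2⁻¹ := by
    funext k
    haveI : ∀ ν, NeZero (Mseq k ν) := fun ν => ⟨(hpos k ν).ne'⟩
    exact tsum_repKernelK_eq (L ^ K) hLK (Mseq k) hm
  rw [hconst] at htann
  exact (tendsto_nhds_unique tendsto_const_nhds htann).symm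

/-! ## §4 Positive-definiteness of `V_N` -/

/-- `S₂^{(K)}_Ω` is translation invariant (`m² > 0`). [cite: King1986, (2.21) p.654] -/
theorem kingS2_transl (N : ℕ) [NeZero N] (M : Fin (d + 1) → ℕ) [∀ ν, NeZero (M ν)] {m2 : ℝ} (hm : 0 < m2) (b b' v : Tor M) :
    kingS2 N M m2 (b + v) (b' + v) = kingS2 N M m2 b b' := by
  rw [kingS2_eq_fourier N M hm, kingS2_eq_fourier N M hm, add_sub_add_right_eq_sub]

/-- ★★ **`V_N` IS A POSITIVE-DEFINITE FUNCTION ON `ℤ^{d+1}`** (`N ≥ 1`, `m² > 0`): `Σ_{z,z′∈s} c_z V_N(z′−z) c_{z′} ≥ 0`. [cite: King1986, Thm 2.1 (2.22) p.654, (2.14) p.653] -/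
theorem kingS2InfK_posSemidef {N : ℕ} [NeZero N] (hN1 : 1 ≤ N) {m2 : ℝ} (hm : 0 < m2) (s : Finset (Fin (d + 1) → ℤ)) (c : (Fin (d + 1) → ℤ) → ℝ) :
    0 ≤ ∑ z ∈ s, ∑ z' ∈ s, c z * kingS2InfK N m2 (z' - z) * c z' := by
  set Mseq : ℕ → Fin (d + 1) → ℕ := fun k _ => k + 1 with hMseq
  have hpos : ∀ k ν, 0 < Mseq k ν := fun k _ => Nat.succ_pos k
  have hlimM : ∀ ν, Tendsto (fun k => (Mseq k ν : ℝ)) atTop atTop := fun ν => by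
    have : Tendsto (fun k : ℕ => ((k : ℝ) + 1)) atTop atTop := tendsto_atTop_add_const_right _ 1 tendsto_natCast_atTop_atTop
    exact this.congr fun k => by simp [hMseq]
  have hterm : ∀ z z', Tendsto (fun k => haveI : ∀ ν, NeZero (Mseq k ν) := fun ν => ⟨(hpos k ν).ne'⟩
      c z * kingS2 N (Mseq k) m2 (fun ν => ((z ν : ℤ) : ZMod (Mseq k ν))) (fun ν => ((z' ν : ℤ) : ZMod (Mseq k ν))) * c z') atTop
      (𝓝 (c z * kingS2InfK N m2 (z' - z) * c z')) := by
    intro z z'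
    have h := tendsto_kingS2_volume (N := N) hN1 hm Mseq hpos hlimM (z' - z)
    refine ((h.const_mul (c z)).mul_const (c z')).congr fun k => ?_
    haveI : ∀ ν, NeZero (Mseq k ν) := fun ν => ⟨(hpos k ν).ne'⟩
    congr 2
    have htr := kingS2_transl N (Mseq k) hm 0 (fun ν => (((z' - z) ν : ℤ) : ZMod (Mseq k ν))) (fun ν => ((z ν : ℤ) : ZMod (Mseq k ν)))
    rw [zero_add] at htr
    rw [← htr]
    congr 1
    funext ν
    simp
  have hsum := tendsto_finsetSum s fun z _ => tendsto_finsetSum s fun z' _ => hterm z z'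
  refine ge_of_tendsto hsum (Filter.Eventually.of_forall fun k => ?_)
  haveI : ∀ ν, NeZero (Mseq k ν) := fun ν => ⟨(hpos k ν).ne'⟩
  have h0 := kingS2_form_nonneg N (Mseq k) hm (fun b => ∑ z ∈ s, if (fun ν => ((z ν : ℤ) : ZMod (Mseq k ν))) = b then c z else 0)
  rw [sum_pushforward_form] at h0
  exact h0

end Summit.QuantumFields.YangMills.BalabanUVNodes.N15KingModelRung

end
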